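import Summits.Ventures.HSemireg.EmbeddedFirstOrderDeformationsCechObstructionSplit
import Summits.Ventures.HSemireg.EmbeddedFirstOrderDeformationsBaseChange

/-!
# Venture HSemireg — PROPOSITION K for the TWISTED DUAL-NUMBER ATLAS `X_ξ`: charts `A_α[ε]`, transitions
# `ψ_αβ = (id + εθ_αβ) ∘ (restriction)`; `Z` lifts to `X_ξ` iff `(θ̄_αβ|_{I_αβ})` is a Čech coboundary

HONEST FRAMING.  Lean side of the computation cell `pub-hsemireg` (track «S4-PUSH» (ii), seat s4-prove-3 g5, second
route for (S5)); log `s4push/prove-3/ATTEMPT-9.md` (file V).  Plain commutative algebra: the abstract thickened atlas of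
`…CechObstruction` SPECIALISED to the atlas of PROPOSITION K (cell text G2-REDUCIBLE-POINT-THEOREM §3 / the (H-arr)
input of the (S5) files): charts `U_α[ε] = Spec A_α[ε]`, overlap rings `A_αβ[ε]`, left restriction `rˡ_αβ[ε]`, right
restriction `ψ_αβ ∘ rʳ_αβ[ε]` with `ψ_αβ = twist θ_αβ = id + εθ_αβ` (`…Cocycle`), for ANY family of derivations `θ_αβ`
of the overlap rings.  No Mathlib scheme, sheaf, Čech-to-derived comparison, abelian variety or semiregularity map is
constructed; nothing here says that HC, HC_CM or HC_AV holds; no object is certified; no Literature fact is declared.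

WHAT (namespace `Summit.Ventures.HSemireg.EmbeddedDeformation`):
* §1 dischargers on the dual numbers: `isThickeningHom_mapRingHom` (`f[ε]` is a morphism of the trivial thickenings
  over `f`), `preservesLifts_mapRingHom_of_isLocalization` (`…BaseChange` §5: restriction to `Spec T⁻¹R` carries flat
  lifts to flat lifts), `isThickeningHom_twist_comp` / `preservesLifts_twist_comp` (post-composition with `ψ = twist θ`);
* §2 **`thickenedAtlas_twisted`** — the twisted dual-number atlas IS a `ThickenedAtlas` as soon as the UNTWISTED
  restrictions `rˡ[ε], rʳ[ε]` carry flat lifts (discharged by §1 for localisations), for every derivation family `θ`;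
* §3 **`transitionDerivation_inl_twist`** — the transition derivation of the two overlap sections `inl` and
  `ψ_αβ ∘ inl` IS `θ_αβ` (pinned by `ε·inl(θ' a) = ψ(inl a) − inl a = ε·inl(θ a)`);
* §4 **`exists_isAtlasLift_twisted_iff`** — PROPOSITION K: `Z = (I_α)` lifts to `X_ξ` (a compatible family of flat
  lifts `K_α ⊆ A_α[ε]`, `K_α·A_αβ[ε] = ψ_αβ(K_β·A_αβ[ε])`) **iff** `θ̄_αβ|_{I_αβ} = φ_β|_{αβ} − φ_α|_{αβ}` for some normal
  vectors `φ_α ∈ Hom(I_α, A_α/I_α)` — «`Z` extends flatly along `A_ξ` ⟺ the Čech cocycle `(π(θ_αβ))` is a coboundary»,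
  at the Čech level, for literal ideals.
NOT typed: `(θ_αβ) ↦ ξ ∈ H¹(X, T_X)` beyond the cochain level (`…KodairaSpencer`), Čech vs. sheaf cohomology, the
étale-local chart of (H-arr), branch-following.

References: R. Hartshorne, *Deformation Theory*, GTM 257 (2010), §2 Prop. 2.3 / Thm. 2.4, §5 Ex. 5.2, §6 Thm. 6.2 (b)
[corpus: book:springernd-deformation-theory p0015–p0016, p0047–p0049, p0054/p0056].
-/

open DualNumber TrivSqZeroExt

namespace Summit.Ventures.HSemireg

namespace EmbeddedDeformation

universe w u

/-! ### §1 Dischargers on the dual numbers -/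

section DualNumber

variable {R S : Type u} [CommRing R] [CommRing S]

/-- `f[ε] : R[ε] → S[ε]` is a morphism of the trivial thickenings over `f` (`fst ∘ f[ε] = f ∘ fst`, `f[ε] ε = ε`).
[folklore] -/
theorem isThickeningHom_mapRingHom (f : R →+* S) :
    IsThickeningHom (fstRingHom R) (ε : R[ε]) (fstRingHom S) (ε : S[ε]) (mapRingHom f) f :=
  ⟨fun z ↦ by rw [fstRingHom_apply, fstRingHom_apply, fst_mapRingHom], mapRingHom_eps f⟩

/-- **Restriction to a basic open carries flat lifts to flat lifts, dual-number form** (`…BaseChange` §5,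
`isEmbeddedDeformation_map_of_isLocalization`, through `isLift_iff_isEmbeddedDeformation`).
[cite: Hartshorne2010, §2 Thm. 2.4 («compatible with localization»)] -/
theorem preservesLifts_mapRingHom_of_isLocalization (T : Submonoid R) [Algebra R S] [IsLocalization T S]
    (I : Ideal R) :
    PreservesLifts (fstRingHom R) (ε : R[ε]) (fstRingHom S) (ε : S[ε]) (mapRingHom (algebraMap R S)) I
      (I.map (algebraMap R S)) :=
  fun _ hK ↦ isLift_iff_isEmbeddedDeformation.2
    (isEmbeddedDeformation_map_of_isLocalization T S I (isLift_iff_isEmbeddedDeformation.1 hK))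

variable {B : Type*} [CommRing B] [Algebra B S]

/-- Post-composing a morphism into the trivial thickening `S[ε]` with a transition automorphism `ψ = twist θ`
(`= id + εθ`) gives a morphism of thickenings over the same map. [cite: Hartshorne2010, §5 Ex. 5.2] -/
theorem isThickeningHom_twist_comp {R' : Type u} [CommRing R'] {π : R' →+* R} {e : R'} {ρ : R' →+* S[ε]}
    {r : R →+* S} (h : IsThickeningHom π e (fstRingHom S) (ε : S[ε]) ρ r) (θ : Derivation B S S) :
    IsThickeningHom π e (fstRingHom S) (ε : S[ε]) ((twist θ : S[ε] →+* S[ε]).comp ρ) r where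
  comm z := by rw [RingHom.comp_apply, RingHom.coe_coe, fstRingHom_apply, fst_twist, ← fstRingHom_apply, h.comm]
  map_eps := by rw [RingHom.comp_apply, h.map_eps, RingHom.coe_coe, twist_eps]

/-- … and preserves flat lifts if the untwisted morphism does (`…Restriction`: isomorphisms of thickenings preserve
lifts; composition). [cite: Hartshorne2010, §6 proof of Thm. 6.2] -/
theorem preservesLifts_twist_comp {R' : Type u} [CommRing R'] {π : R' →+* R} {e : R'} {ρ : R' →+* S[ε]}
    {I : Ideal R} {I' : Ideal S} (h : PreservesLifts π e (fstRingHom S) (ε : S[ε]) ρ I I') (θ : Derivation B S S) :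
    PreservesLifts π e (fstRingHom S) (ε : S[ε]) ((twist θ : S[ε] →+* S[ε]).comp ρ) I I' :=
  h.comp (preservesLifts_ringEquiv (twist θ) (fun z ↦ by rw [fstRingHom_apply, fstRingHom_apply, fst_twist])
    (twist_eps θ) I')

/-- `inl : S → S[ε]` is a section of `fst`. [folklore] -/
theorem fstRingHom_algebraMap (a : S) : fstRingHom S (algebraMap S S[ε] a) = a := by
  rw [fstRingHom_apply, TrivSqZeroExt.algebraMap_eq_inl, fst_inl]

/-- `ψ ∘ inl` is a section of `fst` for `ψ = twist θ`. [folklore] -/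
theorem fstRingHom_twist_algebraMap (θ : Derivation B S S) (a : S) :
    fstRingHom S (((twist θ : S[ε] →+* S[ε]).comp (algebraMap S S[ε])) a) = a := by
  rw [RingHom.comp_apply, RingHom.coe_coe, fstRingHom_apply, fst_twist, ← fstRingHom_apply, fstRingHom_algebraMap]

/-- `f[ε] ∘ inl = inl ∘ f`: the chart section `inl` restricts to the overlap section `inl`. [folklore] -/
theorem mapRingHom_comp_algebraMap (f : R →+* S) :
    (mapRingHom f).comp (algebraMap R R[ε]) = (algebraMap S S[ε]).comp f := by
  ext a
  · rw [RingHom.comp_apply, RingHom.comp_apply, TrivSqZeroExt.algebraMap_eq_inl, TrivSqZeroExt.algebraMap_eq_inl,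
      mapRingHom_inl]
  · rw [RingHom.comp_apply, RingHom.comp_apply, TrivSqZeroExt.algebraMap_eq_inl, TrivSqZeroExt.algebraMap_eq_inl,
      mapRingHom_inl]

/-- **The transition derivation of the sections `inl` and `ψ ∘ inl`, `ψ = twist θ`, IS `θ`**: both satisfy
`ε·inl(· a) = ψ(inl a) − inl a` (`…SmoothSplitting`, `eps_mul_section_transitionDerivation`; `…Cocycle`, `twist_inl`).
[cite: Hartshorne2010, §5 Ex. 5.2] -/
theorem transitionDerivation_inl_twist (θ : Derivation B S S) (a : S) :
    (isFirstOrderThickening_dualNumber S).transitionDerivation (algebraMap S S[ε])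
        ((twist θ : S[ε] →+* S[ε]).comp (algebraMap S S[ε])) (fstRingHom_algebraMap)
        (fstRingHom_twist_algebraMap θ) a = θ a := by
  have hT := isFirstOrderThickening_dualNumber S
  rw [← sub_eq_zero]
  refine hT.eq_zero_of_eps_mul_section (algebraMap S S[ε]) fstRingHom_algebraMap ?_
  rw [map_sub, mul_sub, hT.eps_mul_section_transitionDerivation, RingHom.comp_apply, RingHom.coe_coe,
    TrivSqZeroExt.algebraMap_eq_inl, twist_inl]
  ring

end DualNumber

/-! ### §2 The twisted dual-number atlas is a thickened atlas -/

section Twisted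

variable {ι : Type w} {A : ι → Type u} [∀ α, CommRing (A α)] {A₂ : ι → ι → Type u} [∀ α β, CommRing (A₂ α β)]
variable (rl : ∀ α β, A α →+* A₂ α β) (rr : ∀ α β, A β →+* A₂ α β)
variable (I : ∀ α, Ideal (A α)) (I₂ : ∀ α β, Ideal (A₂ α β)) (θ : ∀ α β, Derivation ℤ (A₂ α β) (A₂ α β))

/-- **The twisted dual-number atlas `X_ξ` is a thickened atlas.**  Charts `A_α[ε] ↠ A_α`, overlaps `A_αβ[ε] ↠ A_αβ`,
left restriction `rˡ_αβ[ε]`, right restriction `ψ_αβ ∘ rʳ_αβ[ε]` with `ψ_αβ = twist θ_αβ = id + εθ_αβ`; hypotheses: the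
UNTWISTED restrictions carry flat lifts of `I_α`, `I_β` to flat lifts of `I_αβ` (for basic-open overlaps:
`preservesLifts_mapRingHom_of_isLocalization`). [cite: Hartshorne2010, §5 Ex. 5.2 / §6 Thm. 6.2] -/
theorem thickenedAtlas_twisted
    (Pl : ∀ α β, PreservesLifts (fstRingHom (A α)) (ε : (A α)[ε]) (fstRingHom (A₂ α β)) (ε : (A₂ α β)[ε])
      (mapRingHom (rl α β)) (I α) (I₂ α β))
    (Pr : ∀ α β, PreservesLifts (fstRingHom (A β)) (ε : (A β)[ε]) (fstRingHom (A₂ α β)) (ε : (A₂ α β)[ε])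
      (mapRingHom (rr α β)) (I β) (I₂ α β)) :
    ThickenedAtlas (fun α ↦ fstRingHom (A α)) (fun α ↦ (ε : (A α)[ε])) (fun α β ↦ fstRingHom (A₂ α β))
      (fun α β ↦ (ε : (A₂ α β)[ε])) (fun α β ↦ mapRingHom (rl α β)) rl
      (fun α β ↦ (twist (θ α β) : (A₂ α β)[ε] →+* (A₂ α β)[ε]).comp (mapRingHom (rr α β))) rr I I₂ where
  thick α := isFirstOrderThickening_dualNumber (A α)
  thick₂ α β := isFirstOrderThickening_dualNumber (A₂ α β)
  homl α β := isThickeningHom_mapRingHom (rl α β)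
  homr α β := isThickeningHom_twist_comp (isThickeningHom_mapRingHom (rr α β)) (θ α β)
  liftsl := Pl
  liftsr α β := preservesLifts_twist_comp (Pr α β) (θ α β)

/-! ### §3–§4 Proposition K for `X_ξ` -/

/-- The chart section `inl : A_β → A_β[ε]` restricts to `ψ_αβ ∘ inl` along the right (twisted) restriction.
[folklore] -/
theorem twist_comp_mapRingHom_comp_algebraMap (α β : ι) :
    ((twist (θ α β) : (A₂ α β)[ε] →+* (A₂ α β)[ε]).comp (mapRingHom (rr α β))).comp (algebraMap (A β) (A β)[ε]) =
      ((twist (θ α β) : (A₂ α β)[ε] →+* (A₂ α β)[ε]).comp (algebraMap (A₂ α β) (A₂ α β)[ε])).comp (rr α β) := by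
  rw [RingHom.comp_assoc, mapRingHom_comp_algebraMap (rr α β), ← RingHom.comp_assoc]

/-- **PROPOSITION K for the twisted dual-number atlas `X_ξ`** (cell text G2-REDUCIBLE-POINT-THEOREM §3, the (H-arr)
input; Hartshorne Thm. 6.2 (b) with the trivial local lifts `I_α·A_α[ε]`): `Z = (I_α)` LIFTS to `X_ξ` — flat lifts
`K_α ⊆ A_α[ε]` of `I_α` with `K_α·A_αβ[ε] = ψ_αβ(K_β·A_αβ[ε])` — **iff** the Čech cochain `(θ̄_αβ|_{I_αβ})`,
`θ̄_αβ|_I (x) = θ_αβ(x) mod I_αβ`, is a COBOUNDARY of normal vectors: `θ̄_αβ|_{I_αβ} = φ_β|_{αβ} − φ_α|_{αβ}`.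
[cite: Hartshorne2010, §6 Thm. 6.2 (b)] -/
theorem exists_isAtlasLift_twisted_iff
    (Pl : ∀ α β, PreservesLifts (fstRingHom (A α)) (ε : (A α)[ε]) (fstRingHom (A₂ α β)) (ε : (A₂ α β)[ε])
      (mapRingHom (rl α β)) (I α) (I₂ α β))
    (Pr : ∀ α β, PreservesLifts (fstRingHom (A β)) (ε : (A β)[ε]) (fstRingHom (A₂ α β)) (ε : (A₂ α β)[ε])
      (mapRingHom (rr α β)) (I β) (I₂ α β)) :
    (∃ K : ∀ α, Ideal (A α)[ε], IsAtlasLift (fun α ↦ fstRingHom (A α)) (fun α ↦ (ε : (A α)[ε]))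
        (fun α β ↦ mapRingHom (rl α β))
        (fun α β ↦ (twist (θ α β) : (A₂ α β)[ε] →+* (A₂ α β)[ε]).comp (mapRingHom (rr α β))) I K) ↔
      ∃ φ : ∀ α, I α →ₗ[A α] A α ⧸ I α, ∀ α β,
        derivToNormal (I₂ α β) (θ α β) =
          resR (thickenedAtlas_twisted rl rr I I₂ θ Pl Pr)
              (isLift_map_chartSection (thickenedAtlas_twisted rl rr I I₂ θ Pl Pr) (fun α ↦ algebraMap (A α) (A α)[ε])
                fun _ ↦ fstRingHom_algebraMap) α β (φ β) -
            resL (thickenedAtlas_twisted rl rr I I₂ θ Pl Pr)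
              (isLift_map_chartSection (thickenedAtlas_twisted rl rr I I₂ θ Pl Pr) (fun α ↦ algebraMap (A α) (A α)[ε])
                fun _ ↦ fstRingHom_algebraMap) α β (φ α) := by
  have key := exists_isAtlasLift_iff_derivToNormal (thickenedAtlas_twisted rl rr I I₂ θ Pl Pr)
    (fun α ↦ algebraMap (A α) (A α)[ε]) (fun _ ↦ fstRingHom_algebraMap)
    (fun α β ↦ algebraMap (A₂ α β) (A₂ α β)[ε]) (fun _ _ ↦ fstRingHom_algebraMap)
    (fun α β ↦ (twist (θ α β) : (A₂ α β)[ε] →+* (A₂ α β)[ε]).comp (algebraMap (A₂ α β) (A₂ α β)[ε]))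
    (fun α β ↦ fstRingHom_twist_algebraMap (θ α β)) (fun α β ↦ mapRingHom_comp_algebraMap (rl α β))
    (twist_comp_mapRingHom_comp_algebraMap rr θ)
  have hθ : ∀ α β, derivToNormal (I₂ α β)
      ((isFirstOrderThickening_dualNumber (A₂ α β)).transitionDerivation (algebraMap (A₂ α β) (A₂ α β)[ε])
        ((twist (θ α β) : (A₂ α β)[ε] →+* (A₂ α β)[ε]).comp (algebraMap (A₂ α β) (A₂ α β)[ε]))
        fstRingHom_algebraMap (fstRingHom_twist_algebraMap (θ α β))) = derivToNormal (I₂ α β) (θ α β) := by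
    intro α β
    apply LinearMap.ext
    intro x
    rw [derivToNormal_apply, derivToNormal_apply, transitionDerivation_inl_twist]
  simp only [hθ] at key
  exact key

end Twisted

end EmbeddedDeformation

end Summit.Ventures.HSemireg
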